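import Literature.Geometry.DiscreteGeometry.SphericalIsoperimetricProof
import HarnessLib

/-!
# The spherical isodiametric inequality on `S²` (Böröczky–Sagmeister, Thm 1.2), PROVED:
# discharge of the named fact `BoroczkySagmeister2019_sphericalIsodiametric`

Topic `Literature/Geometry/DiscreteGeometry`; continues `SphericalTwoPointSymmetrization.lean`
(layer 1: the two-point symmetrization `tps`, `σ(T A) = σ(A)`, the gain inequality
`cvol_tps_inter_cap_ge`) and `SphericalIsoperimetricProof.lean` (layer 2: the Hausdorff
hyperspace of compact subsets of `S²`, upper semicontinuity of `B ↦ σ(B ∩ C)`, density points and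
`exists_reflection_gain`), and ends with
`BoroczkySagmeister2019_sphericalIsodiametric_holds : BoroczkySagmeister2019_sphericalIsodiametric`
— the NAMED FACT of `SphericalIsoperimetric.lean` (the inequality half of Böröczky–Sagmeister's
Theorem 1.2 for `S²`: a subset of the unit sphere of geodesic diameter `≤ D < π` has normalised
measure at most that of a cap of angular radius `D/2`) becomes a theorem of the tree.  No new
definition, no new named fact (net literature debt −1).

## The printed proof and what is formalized

K. J. Böröczky, Á. Sagmeister, *The isodiametric problem on the sphere and in the hyperbolic
space*, Acta Math. Hungar. 160 (2020) 13–32 = arXiv:1812.09753, Theorem 1.2.  Their proof rests on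
(a) Lemma 3.3 — under Hausdorff convergence of nonempty compact sets the diameter is continuous
and the volume is upper semicontinuous — and the existence of `D`-maximal sets (Theorem 3.4 (i),
Blaschke selection); (b) Lemma 5.1 — the two-point symmetrization `τ_H X` of a compact `X` is
compact, `V(τ_H X) = V(X)` (iii) and `diam τ_H X ≤ diam X` (iv) ("if either `x, y ∈ X` or
`x, y ∈ σ_H X` then readily `d(x, y) ≤ diam X`; otherwise … `d(x, y) ≤ d(x, σ_H y) ≤ diam X`");
(c) the identification of the extremal sets as balls (Theorem 5.2 after Aubrun–Fradelizi for
`D ≤ π/2`, and the technical §6 for `π/2 < D < π`).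

Formalized here: (a) as `isClosed_famD` / `isCompact_famD` (the family of nonempty compact
`L ⊆ S²` with `σ(L) ≥ σ(A)` and geodesic diameter `≤ D` is closed, hence compact, in Mathlib's
`TopologicalSpace.NonemptyCompacts ℝ³`), (b) as `angDiamLE_tps` (Lemma 5.1 (iv), the printed
case analysis, with the tree's `angle_le_angle_refl_of_same_side` for the reflection step) and
the tree's `cvol_tps` (Lemma 5.1 (iii)).  DEVIATION for (c), a genuinely shorter road already in
the tree: instead of characterising the maximisers (convexity, normal cones, §6) we run
Benyamini's extremal argument exactly as formalized for the isoperimetric inequality in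
`SphericalIsoperimetricProof.lean` [Schneider2022, proof of Thm 3.4.1]: for any cap `C = B(a, ρ)`
with `σ(C) ≤ σ(A)`, a maximiser of `L ↦ σ(L ∩ C)` over the family CONTAINS `C`
(`exists_mem_superset_sphCap`: otherwise the two-point symmetrization in the bisector of two
density points stays in the family and gains), so `diam C ≤ D`; taking `ρ` slightly larger than
`D/2` (right-continuity of `ρ ↦ σ(B(a, ρ))`, no left-continuity needed) a cap of radius `ρ`
contains two points at angular distance `min(2ρ, π) > D` (`exists_pair_angle_gt`) — contradiction
unless `σ(A) ≤ σ(B(a, D/2))` (`cvol_le_cvol_sphCap_of_angDiamLE`).  The passage from a general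
`X ⊆ S²` to its (compact) closure is `angDiamLE_closure` + monotonicity; the measurability
hypothesis of the named fact is not needed for the inequality.  Only the inequality half of
Theorem 1.2 is stated by the named fact; the equality case is not formalized.

## References

* [BoroczkySagmeister2019] K. J. Böröczky, Á. Sagmeister, Acta Math. Hungar. 160 (2020) 13–32
  (arXiv:1812.09753): Theorem 1.2; Lemma 3.3, Theorem 3.4 (i); Lemma 5.1 (iii)–(iv).
* [Schneider2022] R. Schneider, Convex Cones, LNM 2319, Springer 2022, proof of Thm 3.4.1,
  pp. 124–127 (Benyamini's two-point symmetrization argument).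
-/

noncomputable section

namespace Literature.Geometry.DiscreteGeometry

namespace TwoPointSym

open Real InnerProductGeometry Metric Set NormedSpace RealInnerProductSpace
open _root_.MeasureTheory _root_.MeasureTheory.Measure _root_.Filter _root_.Topology
open scoped ENNReal

/-- `S²` is Mathlib's `Metric.sphere 0 1` (plumbing). [folklore] -/
private theorem unitSphere_eq_sphere'' :
    ({x : EuclideanSpace ℝ (Fin 3) | ‖x‖ = 1} : Set (EuclideanSpace ℝ (Fin 3))) =
      sphere (0 : EuclideanSpace ℝ (Fin 3)) 1 := by
  ext x; simp

/-- `S²` is compact (plumbing, from `isCompact_sphere`). [folklore] -/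
private theorem isCompact_unitSphere'' :
    IsCompact ({x : EuclideanSpace ℝ (Fin 3) | ‖x‖ = 1} : Set (EuclideanSpace ℝ (Fin 3))) := by
  rw [unitSphere_eq_sphere'']; exact isCompact_sphere _ _

/-- Unit vectors are nonzero (plumbing). [folklore] -/
private theorem ne_zero_of_norm_one'' {x : EuclideanSpace ℝ (Fin 3)} (hx : ‖x‖ = 1) : x ≠ 0 := by
  intro h; rw [h, norm_zero] at hx; exact zero_ne_one hx

/-- `∠(x, y) = arccos ⟪x, y⟫` for unit vectors (plumbing). [folklore] -/
private theorem angle_eq_arccos_inner'' {x y : EuclideanSpace ℝ (Fin 3)} (hx : ‖x‖ = 1)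
    (hy : ‖y‖ = 1) : angle x y = Real.arccos ⟪x, y⟫ := by
  unfold angle; rw [hx, hy, mul_one, div_one]

/-! ## Part A.  Lemma 5.1 (iv): two-point symmetrization does not increase the geodesic diameter -/

/-- **Lemma 5.1 (iv)** of Böröczky–Sagmeister for `S²`: `diam τ_H(X) ≤ diam X`, in the tree's
form "`AngDiamLE X D → AngDiamLE (T X) D`" for the two-point symmetrization `tps n` of layer 1.
Printed proof: "If either `x, y ∈ X` or `x, y ∈ σ_H(X)`, then readily `d(x, y) ≤ diam X`.
Otherwise, we may assume that `x ∈ X ∖ σ_H(X)` and `y ∈ σ_H(X) ∖ X`, thus `x, y ∈ H⁺` …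
`d(x, y) ≤ d(x, σ_H(y)) ≤ diam X`" — the last step is `angle_le_angle_refl_of_same_side`.
[cite: BoroczkySagmeister2019, Lemma 5.1 (iv)] -/
theorem angDiamLE_tps {n : EuclideanSpace ℝ (Fin 3)} (hn : ‖n‖ = 1)
    {X : Set (EuclideanSpace ℝ (Fin 3))} (hXs : X ⊆ {x : EuclideanSpace ℝ (Fin 3) | ‖x‖ = 1})
    {D : ℝ} (hX : AngDiamLE X D) : AngDiamLE (tps n X) D := by
  intro x hx y hy
  have hx1 : ‖x‖ = 1 := tps_subset_unitSphere hXs hx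
  have hy1 : ‖y‖ = 1 := tps_subset_unitSphere hXs hy
  -- membership in `T X`: `x ∈ X ∨ ρx ∈ X`, and if one of the two fails then `x ∈ H⁺`
  have hx' : x ∈ X ∨ refl n x ∈ X := by
    rcases hx with ⟨h, -⟩ | ⟨-, h⟩
    · exact Or.inl h
    · exact h
  have hy' : y ∈ X ∨ refl n y ∈ X := by
    rcases hy with ⟨h, -⟩ | ⟨-, h⟩
    · exact Or.inl h
    · exact h
  have hxn : (x ∉ X ∨ refl n x ∉ X) → 0 ≤ ⟪x, n⟫ := by
    intro h
    rcases hx with ⟨h1, h2⟩ | ⟨h3, -⟩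
    · rcases h with h | h
      · exact absurd h1 h
      · exact absurd h2 h
    · exact h3
  have hyn : (y ∉ X ∨ refl n y ∉ X) → 0 ≤ ⟪y, n⟫ := by
    intro h
    rcases hy with ⟨h1, h2⟩ | ⟨h3, -⟩
    · rcases h with h | h
      · exact absurd h1 h
      · exact absurd h2 h
    · exact h3
  by_cases hxX : x ∈ X
  · by_cases hyX : y ∈ X
    · -- both in `X`
      exact hX x hxX y hyX
    · -- `x ∈ X`, `y ∉ X` (so `ρy ∈ X` and `y ∈ H⁺`)
      have hρy : refl n y ∈ X := hy'.resolve_left hyX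
      have hyn0 : 0 ≤ ⟪y, n⟫ := hyn (Or.inl hyX)
      by_cases hρx : refl n x ∈ X
      · -- both in `σ_H X`
        rw [← angle_refl_refl n x y]; exact hX _ hρx _ hρy
      · have hxn0 : 0 ≤ ⟪x, n⟫ := hxn (Or.inr hρx)
        calc angle x y ≤ angle x (refl n y) :=
              angle_le_angle_refl_of_same_side hn hx1 hy1 (mul_nonneg hxn0 hyn0)
          _ ≤ D := hX x hxX _ hρy
  · -- `x ∉ X` (so `ρx ∈ X` and `x ∈ H⁺`)
    have hρx : refl n x ∈ X := hx'.resolve_left hxX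
    have hxn0 : 0 ≤ ⟪x, n⟫ := hxn (Or.inl hxX)
    by_cases hρy : refl n y ∈ X
    · rw [← angle_refl_refl n x y]; exact hX _ hρx _ hρy
    · have hyX : y ∈ X := hy'.resolve_right hρy
      have hyn0 : 0 ≤ ⟪y, n⟫ := hyn (Or.inr hρy)
      calc angle x y = angle y x := angle_comm x y
        _ ≤ angle y (refl n x) :=
            angle_le_angle_refl_of_same_side hn hy1 hx1 (mul_nonneg hyn0 hxn0)
        _ ≤ D := hX y hyX _ hρx

/-! ## Part B.  Closure, and two far points in a cap -/

/-- The geodesic diameter bound passes to the closure (the angle is continuous on pairs of unit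
vectors and the unit sphere is closed) — the reduction of Theorem 1.2 to compact sets ("equality
holds if and only if the closure of `X` is a ball": the printed statement is insensitive to
closure). [cite: BoroczkySagmeister2019, Theorem 1.2 and §3 (diameter under Hausdorff limits, Lemma 3.3 (i))] -/
theorem angDiamLE_closure {X : Set (EuclideanSpace ℝ (Fin 3))}
    (hXs : X ⊆ {x : EuclideanSpace ℝ (Fin 3) | ‖x‖ = 1}) {D : ℝ} (hX : AngDiamLE X D) :
    AngDiamLE (closure X) D := by
  have hS2 : IsClosed ({x : EuclideanSpace ℝ (Fin 3) | ‖x‖ = 1} : Set (EuclideanSpace ℝ (Fin 3))) :=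
    isCompact_unitSphere''.isClosed
  -- the closed set `S = (S² × S²) ∩ angle⁻¹ (-∞, D]`
  set S : Set (EuclideanSpace ℝ (Fin 3) × EuclideanSpace ℝ (Fin 3)) :=
    (({x : EuclideanSpace ℝ (Fin 3) | ‖x‖ = 1} : Set (EuclideanSpace ℝ (Fin 3))) ×ˢ
      ({x : EuclideanSpace ℝ (Fin 3) | ‖x‖ = 1} : Set (EuclideanSpace ℝ (Fin 3)))) ∩
    (fun p : EuclideanSpace ℝ (Fin 3) × EuclideanSpace ℝ (Fin 3) => angle p.1 p.2) ⁻¹' Iic D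
    with hS
  have hcont : ContinuousOn
      (fun p : EuclideanSpace ℝ (Fin 3) × EuclideanSpace ℝ (Fin 3) => angle p.1 p.2)
      (({x : EuclideanSpace ℝ (Fin 3) | ‖x‖ = 1} : Set (EuclideanSpace ℝ (Fin 3))) ×ˢ
        ({x : EuclideanSpace ℝ (Fin 3) | ‖x‖ = 1} : Set (EuclideanSpace ℝ (Fin 3)))) := by
    intro p hp
    exact (continuousAt_angle (ne_zero_of_norm_one'' hp.1)
      (ne_zero_of_norm_one'' hp.2)).continuousWithinAt
  have hSc : IsClosed S := hcont.preimage_isClosed_of_isClosed (hS2.prod hS2) isClosed_Iic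
  have hXX : X ×ˢ X ⊆ S := by
    rintro ⟨x, y⟩ ⟨hx, hy⟩
    exact ⟨⟨hXs hx, hXs hy⟩, hX x hx y hy⟩
  intro x hx y hy
  have hxy : (x, y) ∈ closure (X ×ˢ X) := by
    rw [closure_prod_eq]; exact ⟨hx, hy⟩
  exact (hSc.closure_subset_iff.2 hXX hxy).2

/-- A cap `B(a, ρ)` with `ρ > D/2` (`0 ≤ D < π`) contains two points at geodesic distance `> D`:
the points at angle `θ = min(ρ, π/2)` from `a` on opposite sides of a great circle through `a`
are at angle `2θ = min(2ρ, π) > D`.  (So a cap of geodesic diameter `≤ D` has radius `≤ D/2`: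
"the maximality of `V(C)` implies that the radius of `C` is `D/2`".)
[cite: BoroczkySagmeister2019, proof of Theorem 1.2 (§5, end: the radius of the extremal ball is D/2)] -/
theorem exists_pair_angle_gt {a : EuclideanSpace ℝ (Fin 3)} (ha : ‖a‖ = 1) {D ρ : ℝ}
    (hD0 : 0 ≤ D) (hDπ : D < π) (hρ : D / 2 < ρ) :
    ∃ x ∈ sphCap a ρ, ∃ y ∈ sphCap a ρ, D < angle x y := by
  obtain ⟨u, hu1, hau⟩ := exists_unit_orthogonal ha
  have hπ : 0 < π := Real.pi_pos
  set θ := min ρ (π / 2) with hθ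
  have hθρ : θ ≤ ρ := min_le_left _ _
  have hθ2 : θ ≤ π / 2 := min_le_right _ _
  have hθ0 : 0 ≤ θ := le_min (by linarith) (by linarith)
  have hθπ : θ ≤ π := by linarith
  have hDθ : D < 2 * θ := by
    rcases le_total ρ (π / 2) with h | h
    · rw [hθ, min_eq_left h]; linarith
    · rw [hθ, min_eq_right h]; linarith
  have h2θ0 : 0 ≤ 2 * θ := by linarith
  have h2θπ : 2 * θ ≤ π := by linarith
  have haa : ⟪a, a⟫ = 1 := by rw [real_inner_self_eq_norm_sq, ha]; norm_num
  have huu : ⟪u, u⟫ = 1 := by rw [real_inner_self_eq_norm_sq, hu1]; norm_num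
  have hua : ⟪u, a⟫ = 0 := by rw [real_inner_comm]; exact hau
  set c := Real.cos θ with hc
  set s := Real.sin θ with hs
  have hcs : c ^ 2 + s ^ 2 = 1 := by rw [hc, hs]; exact Real.cos_sq_add_sin_sq θ
  set x : EuclideanSpace ℝ (Fin 3) := c • a + s • u with hx
  set y : EuclideanSpace ℝ (Fin 3) := c • a + (-s) • u with hy
  have hax : ⟪a, x⟫ = c := by
    simp only [hx, inner_add_right, real_inner_smul_right, haa, hau, mul_one, mul_zero, add_zero]
  have hay : ⟪a, y⟫ = c := by
    simp only [hy, inner_add_right, real_inner_smul_right, haa, hau, mul_one, mul_zero, add_zero]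
  have hxx : ⟪x, x⟫ = 1 := by
    simp only [hx, inner_add_left, inner_add_right, real_inner_smul_left, real_inner_smul_right,
      haa, hau, hua, huu]
    linear_combination hcs
  have hyy : ⟪y, y⟫ = 1 := by
    simp only [hy, inner_add_left, inner_add_right, real_inner_smul_left, real_inner_smul_right,
      haa, hau, hua, huu]
    linear_combination hcs
  have hxy : ⟪x, y⟫ = Real.cos (2 * θ) := by
    rw [Real.cos_two_mul, ← hc]
    simp only [hx, hy, inner_add_left, inner_add_right, real_inner_smul_left, real_inner_smul_right,
      haa, hau, hua, huu]
    linear_combination -hcs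
  have hx1 : ‖x‖ = 1 := by
    have h : ‖x‖ ^ 2 = 1 := by rw [← real_inner_self_eq_norm_sq]; exact hxx
    exact (pow_eq_one_iff_of_nonneg (norm_nonneg x) two_ne_zero).1 h
  have hy1 : ‖y‖ = 1 := by
    have h : ‖y‖ ^ 2 = 1 := by rw [← real_inner_self_eq_norm_sq]; exact hyy
    exact (pow_eq_one_iff_of_nonneg (norm_nonneg y) two_ne_zero).1 h
  have hangx : angle a x = θ := by
    rw [angle_eq_arccos_inner'' ha hx1, hax, hc, Real.arccos_cos hθ0 hθπ]
  have hangy : angle a y = θ := by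
    rw [angle_eq_arccos_inner'' ha hy1, hay, hc, Real.arccos_cos hθ0 hθπ]
  have hangxy : angle x y = 2 * θ := by
    rw [angle_eq_arccos_inner'' hx1 hy1, hxy, Real.arccos_cos h2θ0 h2θπ]
  refine ⟨x, ⟨hx1, ?_⟩, y, ⟨hy1, ?_⟩, ?_⟩
  · rw [hangx]; exact hθρ
  · rw [hangy]; exact hθρ
  · rw [hangxy]; exact hDθ

/-! ## Part C.  The hyperspace: the family `𝓓_{A,D}` is closed; `L ↦ σ(L ∩ C)` is u.s.c. -/

section Hyperspace

open TopologicalSpace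

/-- **Lemma 3.3 for `S²`, as a closedness statement.**  For `A ⊆ S²` and `D ∈ ℝ` the family
`𝓓_{A,D}` of nonempty compact `L ⊆ S²` with `σ(L) ≥ σ(A)` and geodesic diameter `≤ D` is closed in
the Hausdorff hyperspace: under Hausdorff convergence "(i) `diam C = lim diam C_m`" and "(ii)
`V(C) ≥ limsup V(C_m)`" (for (ii): `C_m ⊆ C_δ` eventually and `σ(C_δ) ↓ σ(C)`, the tree's
`tendsto_cvol_sphNhd`). [cite: BoroczkySagmeister2019, Lemma 3.3 (i)–(ii)] -/
theorem isClosed_famD (A : Set (EuclideanSpace ℝ (Fin 3))) (D : ℝ) :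
    IsClosed {L : TopologicalSpace.NonemptyCompacts (EuclideanSpace ℝ (Fin 3)) |
      (L : Set (EuclideanSpace ℝ (Fin 3))) ⊆ {x : EuclideanSpace ℝ (Fin 3) | ‖x‖ = 1} ∧
      cvol A ≤ cvol (L : Set (EuclideanSpace ℝ (Fin 3))) ∧
      AngDiamLE (L : Set (EuclideanSpace ℝ (Fin 3))) D} := by
  apply isClosed_of_closure_subset
  intro L hL
  rw [Metric.mem_closure_iff] at hL
  -- (o) L ⊆ S²
  have hLs : (L : Set (EuclideanSpace ℝ (Fin 3))) ⊆ {x : EuclideanSpace ℝ (Fin 3) | ‖x‖ = 1} := by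
    intro x hx
    apply isCompact_unitSphere''.isClosed.closure_subset
    rw [Metric.mem_closure_iff]
    intro δ hδ
    obtain ⟨L', hL', hd⟩ := hL δ hδ
    rw [NonemptyCompacts.dist_eq] at hd
    obtain ⟨y, hy, hxy⟩ := exists_dist_lt_of_hausdorffDist_lt hx hd
      (hausdorffEDist_ne_top_of_nonempty_of_bounded L.nonempty L'.nonempty L.isCompact.isBounded
        L'.isCompact.isBounded)
    exact ⟨y, hL'.1 hy, hxy⟩
  -- approximants at Hausdorff distance < (2/π)·(1/(k+1))
  have hπ : 0 < π := Real.pi_pos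
  have happrox : ∀ k : ℕ, ∃ L' ∈ {L : TopologicalSpace.NonemptyCompacts (EuclideanSpace ℝ (Fin 3)) |
      (L : Set (EuclideanSpace ℝ (Fin 3))) ⊆ {x : EuclideanSpace ℝ (Fin 3) | ‖x‖ = 1} ∧
      cvol A ≤ cvol (L : Set (EuclideanSpace ℝ (Fin 3))) ∧
      AngDiamLE (L : Set (EuclideanSpace ℝ (Fin 3))) D},
      (L : Set (EuclideanSpace ℝ (Fin 3))) ⊆ sphNhd (L' : Set (EuclideanSpace ℝ (Fin 3))) (1 / ((k:ℝ) + 1)) ∧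
      (L' : Set (EuclideanSpace ℝ (Fin 3))) ⊆ sphNhd (L : Set (EuclideanSpace ℝ (Fin 3))) (1 / ((k:ℝ) + 1)) := by
    intro k
    have hδ : (0:ℝ) < 2 / π * (1 / ((k:ℝ) + 1)) := by positivity
    obtain ⟨L', hL', hd⟩ := hL _ hδ
    have e : π / 2 * (2 / π * (1 / ((k:ℝ) + 1))) = 1 / ((k:ℝ) + 1) := by
      field_simp
    refine ⟨L', hL', ?_, ?_⟩
    · have := subset_sphNhd_of_dist_lt hLs hL'.1 hd
      rwa [e] at this
    · rw [dist_comm] at hd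
      have := subset_sphNhd_of_dist_lt hL'.1 hLs hd
      rwa [e] at this
  have hLc : IsCompact (L : Set (EuclideanSpace ℝ (Fin 3))) := L.isCompact
  refine ⟨hLs, ?_, ?_⟩
  · -- (ii) σ(A) ≤ σ(L): σ(A) ≤ σ(L'_k) ≤ σ(L_{δ_k}) → σ(L)
    have hk : ∀ k : ℕ, cvol A ≤ cvol (sphNhd (L : Set (EuclideanSpace ℝ (Fin 3))) (0 + 1 / ((k:ℝ) + 1))) := by
      intro k
      obtain ⟨L', hL', -, h2⟩ := happrox k
      rw [zero_add]
      exact hL'.2.1.trans (cvol_mono h2)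
    have hlim := tendsto_cvol_sphNhd hLc hLs 0
    rw [sphNhd_zero hLs] at hlim
    exact ge_of_tendsto' hlim hk
  · -- (i) the diameter bound survives: ∠(x,y) ≤ δ_k + D + δ_k for all k
    intro x hx y hy
    by_contra hlt
    push Not at hlt
    obtain ⟨k, hk⟩ := exists_nat_one_div_lt (half_pos (sub_pos.2 hlt))
    obtain ⟨L', hL', h1, -⟩ := happrox k
    obtain ⟨-, x', hx', hxx'⟩ := h1 hx
    obtain ⟨-, y', hy', hyy'⟩ := h1 hy
    have hd : angle x' y' ≤ D := hL'.2.2 x' hx' y' hy'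
    have hy'y : angle y' y ≤ 1 / ((k:ℝ) + 1) := by rw [angle_comm]; exact hyy'
    have h3 : angle x y ≤ angle x x' + angle x' y := angle_le_angle_add_angle _ _ _
    have h4 : angle x' y ≤ angle x' y' + angle y' y := angle_le_angle_add_angle _ _ _
    linarith

/-- `𝓓_{A,D}` is compact (closed inside the compact set of nonempty compact subsets of the sphere —
"the space of non-empty compact subsets … is locally compact according to the Blaschke Selection
Theorem"). [cite: BoroczkySagmeister2019, Theorem 3.2 (Blaschke) and Theorem 3.4 (i)] -/
theorem isCompact_famD (A : Set (EuclideanSpace ℝ (Fin 3))) (D : ℝ) :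
    IsCompact {L : TopologicalSpace.NonemptyCompacts (EuclideanSpace ℝ (Fin 3)) |
      (L : Set (EuclideanSpace ℝ (Fin 3))) ⊆ {x : EuclideanSpace ℝ (Fin 3) | ‖x‖ = 1} ∧
      cvol A ≤ cvol (L : Set (EuclideanSpace ℝ (Fin 3))) ∧
      AngDiamLE (L : Set (EuclideanSpace ℝ (Fin 3))) D} :=
  (TopologicalSpace.NonemptyCompacts.isCompact_subsets_of_isCompact isCompact_unitSphere'').of_isClosed_subset
    (isClosed_famD A D) (fun _ hL => hL.1)

/-- `L ↦ σ(L ∩ C)` is upper semicontinuous on the nonempty compact subsets of `S²`, for a closed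
`C ⊆ S²` — the tree's `upperSemicontinuousOn_cvol_inter` (stated there on the isoperimetric family
`𝓑_A`) verbatim on the larger family; the printed ingredient is Lemma 3.3 (ii) applied to
`L_m ∩ C ⊆ (L ∩ C_δ)_δ`. [cite: Schneider2022, Lemma 3.4.2 (p. 126)]
[cite: BoroczkySagmeister2019, Lemma 3.3 (ii)] -/
theorem upperSemicontinuousOn_cvol_inter_sphere {C : Set (EuclideanSpace ℝ (Fin 3))}
    (hC : IsClosed C) (hCs : C ⊆ {x : EuclideanSpace ℝ (Fin 3) | ‖x‖ = 1}) :
    UpperSemicontinuousOn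
      (fun L : NonemptyCompacts (EuclideanSpace ℝ (Fin 3)) =>
        cvol ((L : Set (EuclideanSpace ℝ (Fin 3))) ∩ C))
      {L : TopologicalSpace.NonemptyCompacts (EuclideanSpace ℝ (Fin 3)) |
        (L : Set (EuclideanSpace ℝ (Fin 3))) ⊆ {x : EuclideanSpace ℝ (Fin 3) | ‖x‖ = 1}} := by
  intro L hL y hy
  have hLs : (L : Set (EuclideanSpace ℝ (Fin 3))) ⊆ {x : EuclideanSpace ℝ (Fin 3) | ‖x‖ = 1} := hL
  have hLc : IsClosed (L : Set (EuclideanSpace ℝ (Fin 3))) := L.isCompact.isClosed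
  have hCc : IsCompact C := isCompact_unitSphere''.of_isClosed_subset hC hCs
  -- the shrinking family t k = (L ∩ C_{δ_k})_{δ_k}
  set t : ℕ → Set (EuclideanSpace ℝ (Fin 3)) := fun k =>
    ball (0:(EuclideanSpace ℝ (Fin 3))) 1 ∩
      rayCone (sphNhd ((L : Set (EuclideanSpace ℝ (Fin 3))) ∩ sphNhd C (1 / ((k:ℝ) + 1)))
        (1 / ((k:ℝ) + 1)))
    with ht
  have hcpt : ∀ k, IsCompact ((L : Set (EuclideanSpace ℝ (Fin 3))) ∩ sphNhd C (1 / ((k:ℝ) + 1))) :=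
    fun k => L.isCompact.inter_right (isClosed_sphNhd hCc hCs _)
  have hsub : ∀ k, ((L : Set (EuclideanSpace ℝ (Fin 3))) ∩ sphNhd C (1 / ((k:ℝ) + 1))) ⊆
      {x : EuclideanSpace ℝ (Fin 3) | ‖x‖ = 1} := fun k x hx => hLs hx.1
  have hmeas : ∀ k, NullMeasurableSet (t k) volume := fun k =>
    (measurableSet_ball.inter (measurableSet_rayCone
      (measurableSet_sphNhd (hcpt k) (hsub k) _))).nullMeasurableSet
  have hanti : Antitone t := by
    intro j k hjk
    have hj : (0:ℝ) < (j:ℝ) + 1 := by positivity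
    have hle : (1:ℝ) / ((k:ℝ) + 1) ≤ 1 / ((j:ℝ) + 1) :=
      one_div_le_one_div_of_le hj (by exact_mod_cast Nat.succ_le_succ hjk)
    apply inter_subset_inter_right _ (rayCone_mono _)
    exact (sphNhd_mono (inter_subset_inter_right _ (sphNhd_mono_radius C hle)) _).trans
      (sphNhd_mono_radius _ hle)
  have hfin : ∃ k, volume (t k) ≠ ⊤ :=
    ⟨0, (lt_of_le_of_lt (measure_mono inter_subset_left) measure_ball_lt_top).ne⟩
  have hlim := tendsto_measure_iInter_atTop hmeas hanti hfin
  have hI : (⋂ k, t k) = ball (0:(EuclideanSpace ℝ (Fin 3))) 1 ∩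
      rayCone ((L : Set (EuclideanSpace ℝ (Fin 3))) ∩ C) := by
    rw [ht]; simp only
    rw [← inter_iInter, ← rayCone_iInter, iInter_sphNhd_inter hLc hLs hC hCs]
  rw [hI] at hlim
  -- pick k with cvol (t k) < y
  have hev : ∀ᶠ k in atTop, (volume ∘ t) k < y := hlim (Iio_mem_nhds hy)
  obtain ⟨k, hk⟩ := hev.exists
  simp only [Function.comp] at hk
  -- neighbourhood in the hyperspace
  rw [eventually_nhdsWithin_iff, Metric.eventually_nhds_iff]
  have hπ : 0 < π := Real.pi_pos
  refine ⟨2 / π * (1 / ((k:ℝ) + 1)), by positivity, fun L' hd hL' => ?_⟩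
  have hL's : (L' : Set (EuclideanSpace ℝ (Fin 3))) ⊆ {x : EuclideanSpace ℝ (Fin 3) | ‖x‖ = 1} := hL'
  have e : π / 2 * (2 / π * (1 / ((k:ℝ) + 1))) = 1 / ((k:ℝ) + 1) := by field_simp
  have hsub' : (L' : Set (EuclideanSpace ℝ (Fin 3))) ⊆
      sphNhd (L : Set (EuclideanSpace ℝ (Fin 3))) (1 / ((k:ℝ) + 1)) := by
    have := subset_sphNhd_of_dist_lt hL's hLs hd
    rwa [e] at this
  have hinc : (L' : Set (EuclideanSpace ℝ (Fin 3))) ∩ C ⊆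
      sphNhd ((L : Set (EuclideanSpace ℝ (Fin 3))) ∩ sphNhd C (1 / ((k:ℝ) + 1))) (1 / ((k:ℝ) + 1)) := by
    rintro x ⟨hxL', hxC⟩
    obtain ⟨hx1, z, hz, hxz⟩ := hsub' hxL'
    refine ⟨hx1, z, ⟨hz, hLs hz, x, hxC, ?_⟩, hxz⟩
    rw [angle_comm]; exact hxz
  calc cvol ((L' : Set (EuclideanSpace ℝ (Fin 3))) ∩ C) ≤ volume (t k) := cvol_mono hinc
    _ < y := hk

end Hyperspace

/-! ## Part D.  The extremal argument: a maximiser of `σ(· ∩ C)` contains the cap `C` -/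

/-- **The two-point-symmetrization extremal argument** (Benyamini, as printed in Schneider's
proof of Thm 3.4.1 and formalized in `exists_superset_cap`), for an ABSTRACT family: let `𝓕` be a
nonempty closed family of nonempty compact subsets of `S²`, stable under every two-point
symmetrization `T_H`, all of whose members have measure at least that of the cap `C = B(a, r)`
(`r > 0`).  Then some member of `𝓕` CONTAINS `C`: a maximiser `B` of the u.s.c. functional
`L ↦ σ(L ∩ C)` on the compact `𝓕` does, for otherwise `σ(C ∖ B) > 0`, hence `σ(B ∖ C) > 0`, and
the symmetrization of `B` in the bisector of two density points lies in `𝓕` and has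
`σ(T_H B ∩ C) > σ(B ∩ C)`.  (Used below with Böröczky–Sagmeister's family of sets of diameter
`≤ D`, in place of their characterisation of `D`-maximal sets.)
[cite: Schneider2022, Theorem 3.4.1, proof (pp. 126–127)]
[cite: BoroczkySagmeister2019, Theorem 3.4 (i) and Lemma 5.1] -/
theorem exists_mem_superset_sphCap
    {𝓕 : Set (TopologicalSpace.NonemptyCompacts (EuclideanSpace ℝ (Fin 3)))}
    (hne : 𝓕.Nonempty) (hcl : IsClosed 𝓕)
    (hsub : ∀ L ∈ 𝓕, (L : Set (EuclideanSpace ℝ (Fin 3))) ⊆ {x : EuclideanSpace ℝ (Fin 3) | ‖x‖ = 1})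
    (htps : ∀ L ∈ 𝓕, ∀ n : EuclideanSpace ℝ (Fin 3), ‖n‖ = 1 →
      ∀ M : TopologicalSpace.NonemptyCompacts (EuclideanSpace ℝ (Fin 3)),
        (M : Set (EuclideanSpace ℝ (Fin 3))) = tps n (L : Set (EuclideanSpace ℝ (Fin 3))) → M ∈ 𝓕)
    {a : EuclideanSpace ℝ (Fin 3)} (ha : ‖a‖ = 1) {r : ℝ} (hr0 : 0 < r)
    (hvol : ∀ L ∈ 𝓕, cvol (sphCap a r) ≤ cvol (L : Set (EuclideanSpace ℝ (Fin 3)))) :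
    ∃ L ∈ 𝓕, sphCap a r ⊆ (L : Set (EuclideanSpace ℝ (Fin 3))) := by
  set C := sphCap a r with hCdef
  have hCc : IsClosed C := isClosed_sphCap (ne_zero_of_norm_one'' ha) r
  have hCs : C ⊆ {x : EuclideanSpace ℝ (Fin 3) | ‖x‖ = 1} := fun x hx => hx.1
  have hCm : MeasurableSet C := hCc.measurableSet
  have h𝓕sub : 𝓕 ⊆ {L : TopologicalSpace.NonemptyCompacts (EuclideanSpace ℝ (Fin 3)) |
      (L : Set (EuclideanSpace ℝ (Fin 3))) ⊆ {x : EuclideanSpace ℝ (Fin 3) | ‖x‖ = 1}} :=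
    fun L hL => hsub L hL
  have hcpt : IsCompact 𝓕 :=
    (TopologicalSpace.NonemptyCompacts.isCompact_subsets_of_isCompact isCompact_unitSphere'').of_isClosed_subset
      hcl h𝓕sub
  -- the maximiser
  obtain ⟨B₀, hB₀, hmax⟩ :=
    ((upperSemicontinuousOn_cvol_inter_sphere hCc hCs).mono h𝓕sub).exists_isMaxOn hne hcpt
  set B : Set (EuclideanSpace ℝ (Fin 3)) := (B₀ : Set (EuclideanSpace ℝ (Fin 3))) with hBdef
  have hBs : B ⊆ {x : EuclideanSpace ℝ (Fin 3) | ‖x‖ = 1} := hsub B₀ hB₀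
  have hBc : IsCompact B := B₀.isCompact
  have hBm : MeasurableSet B := hBc.isClosed.measurableSet
  refine ⟨B₀, hB₀, ?_⟩
  -- claim: C ⊆ B
  by_contra hCB
  rw [Set.not_subset] at hCB
  obtain ⟨v, hvC, hvB⟩ := hCB
  obtain ⟨δ, hδ, hball⟩ := Metric.isOpen_iff.1 hBc.isClosed.isOpen_compl v hvB
  obtain ⟨w, η, hw1, hη, hcap⟩ := exists_sphCap_subset ha hr0 hvC hδ
  -- σ(C ∖ B) > 0 and σ(B ∖ C) ≥ σ(C ∖ B)
  have hG0 : 0 < cvol (C \ B) := by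
    refine lt_of_lt_of_le (cvol_sphCap_pos hw1 hη) (cvol_mono fun u hu => ?_)
    obtain ⟨huC, hub⟩ := hcap hu
    exact ⟨huC, hball hub⟩
  have hFG : cvol (C \ B) ≤ cvol (B \ C) := by
    have h1 := cvol_inter_add_diff B hCm
    have h2 := cvol_inter_add_diff C hBm
    rw [inter_comm] at h2
    have h3 : cvol C ≤ cvol B := hvol B₀ hB₀
    rw [← h1, ← h2] at h3
    exact (ENNReal.add_le_add_iff_left (cvol_ne_top _)).1 h3
  have hF0 : 0 < cvol (B \ C) := lt_of_lt_of_le hG0 hFG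
  -- density points and the bisector
  have hdisj : Disjoint (B \ C) (C \ B) := Set.disjoint_left.2 fun z hz hz' => hz.2 hz'.1
  obtain ⟨x, hxF, y, hyG, hxy, hgain⟩ := exists_reflection_gain (hBm.diff hCm) (hCm.diff hBm)
    (fun z hz => hBs hz.1) (fun z hz => hCs hz.1) hF0 hG0 hdisj
  set n := NormedSpace.normalize (y - x) with hn
  have hyx0 : y - x ≠ 0 := sub_ne_zero.2 (Ne.symm hxy)
  have hn1 : ‖n‖ = 1 := norm_normalize_eq_one_iff.2 hyx0
  have hx1 : ‖x‖ = 1 := hBs hxF.1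
  have hy1 : ‖y‖ = 1 := hCs hyG.1
  -- the centre `a` of the cap lies strictly on the positive side of the bisector
  have hay : angle a y ≤ r := hyG.1.2
  have hax : r < angle a x := lt_of_not_ge fun h => hxF.2 ⟨hx1, h⟩
  have hcos : ⟪a, x⟫ < ⟪a, y⟫ := by
    rw [inner_eq_cos_angle_of_norm_eq_one ha hx1, inner_eq_cos_angle_of_norm_eq_one ha hy1]
    exact Real.cos_lt_cos_of_nonneg_of_le_pi (angle_nonneg _ _) (angle_le_pi _ _)
      (lt_of_le_of_lt hay hax)
  have han : 0 < ⟪a, n⟫ := by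
    rw [hn, NormedSpace.normalize, real_inner_smul_right, inner_sub_right]
    exact mul_pos (inv_pos.2 (norm_pos_iff.2 hyx0)) (by linarith)
  -- the symmetrized competitor T = T_H B
  set T := tps n B with hT
  have hTc : IsCompact T :=
    isCompact_unitSphere''.of_isClosed_subset (isClosed_tps hBc.isClosed) (tps_subset_unitSphere hBs)
  have hTne : T.Nonempty := tps_nonempty hn1 B₀.nonempty
  have hT_mem : (⟨⟨T, hTc⟩, hTne⟩ : TopologicalSpace.NonemptyCompacts (EuclideanSpace ℝ (Fin 3))) ∈ 𝓕 :=
    htps B₀ hB₀ n hn1 _ rfl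
  have hle : cvol (T ∩ C) ≤ cvol (B ∩ C) := hmax hT_mem
  -- the gain
  have hgain' := cvol_tps_inter_cap_ge hn1 ha han.le r hBm
  have hM : (B \ C) ∩ refl n ⁻¹' (C \ B) ⊆
      {u | u ∈ B ∧ ⟪u, n⟫ < 0 ∧ u ∉ C ∧ refl n u ∈ C ∧ refl n u ∉ B} := by
    rintro u ⟨⟨huB, huC⟩, hρuC, hρuB⟩
    refine ⟨huB, ?_, huC, hρuC, hρuB⟩
    have hu1 : ‖u‖ = 1 := hBs huB
    have hρu1 : ‖refl n u‖ = 1 := by rw [norm_refl, hu1]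
    have h1 : ⟪a, u⟫ < ⟪a, refl n u⟫ := by
      rw [inner_eq_cos_angle_of_norm_eq_one ha hu1, inner_eq_cos_angle_of_norm_eq_one ha hρu1]
      apply Real.cos_lt_cos_of_nonneg_of_le_pi (angle_nonneg _ _) (angle_le_pi _ _)
      exact lt_of_le_of_lt hρuC.2 (lt_of_not_ge fun h => huC ⟨hu1, h⟩)
    rw [← real_inner_comm a (refl n u), ← real_inner_comm a u, inner_refl_left hn1] at h1
    by_contra hge
    push Not at hge
    have := mul_nonneg hge han.le
    nlinarith
  have hsum : cvol (B ∩ C) + cvol ((B \ C) ∩ refl n ⁻¹' (C \ B)) ≤ cvol (T ∩ C) :=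
    le_trans (add_le_add le_rfl (cvol_mono hM)) hgain'
  have hlt : cvol (B ∩ C) < cvol (B ∩ C) + cvol ((B \ C) ∩ refl n ⁻¹' (C \ B)) :=
    ENNReal.lt_add_right (cvol_ne_top _) hgain.ne'
  exact absurd (hlt.trans_le (hsum.trans hle)) (lt_irrefl _)

/-! ## Part E.  Assembly: the isodiametric inequality for compact sets, then for all sets -/

/-- **Theorem 1.2 for compact sets (inequality half), on `S²`.**  For a nonempty compact
`A ⊆ S²` of geodesic diameter `≤ D`, `0 < D < π`: `σ(A) ≤ σ(B(a, D/2))`.  Proof: otherwise, by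
right-continuity of `ρ ↦ σ(B(a, ρ))` there is `ρ > D/2` with `σ(B(a, ρ)) ≤ σ(A)`; the extremal
argument over Böröczky–Sagmeister's family `𝓓_{A,D}` (closed: Lemma 3.3; stable under `T_H`:
Lemma 5.1 (iii)–(iv)) produces a member of diameter `≤ D` containing `B(a, ρ)`, which contains two
points at geodesic distance `> D`. [cite: BoroczkySagmeister2019, Theorem 1.2 (proof: Theorem 3.4, Lemma 5.1, §§5–6)]
[cite: Schneider2022, Theorem 3.4.1, proof (pp. 126–127)] -/
theorem cvol_le_cvol_sphCap_of_angDiamLE {A : Set (EuclideanSpace ℝ (Fin 3))} (hAne : A.Nonempty)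
    (hAc : IsCompact A) (hAs : A ⊆ {x : EuclideanSpace ℝ (Fin 3) | ‖x‖ = 1}) {D : ℝ}
    (hD0 : 0 < D) (hDπ : D < π) (hAD : AngDiamLE A D) {a : EuclideanSpace ℝ (Fin 3)}
    (ha : ‖a‖ = 1) : cvol A ≤ cvol (sphCap a (D / 2)) := by
  by_contra hlt
  push Not at hlt
  have ha0 : a ≠ 0 := ne_zero_of_norm_one'' ha
  -- right-continuity of ρ ↦ σ(B(a, ρ)) at D/2: a slightly larger cap still has σ < σ(A)
  set C₀ := sphCap a (D / 2) with hC₀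
  have hC₀s : C₀ ⊆ {x : EuclideanSpace ℝ (Fin 3) | ‖x‖ = 1} := fun x hx => hx.1
  have hC₀c : IsCompact C₀ :=
    isCompact_unitSphere''.of_isClosed_subset (isClosed_sphCap ha0 _) hC₀s
  have hlim := tendsto_cvol_sphNhd hC₀c hC₀s 0
  rw [sphNhd_zero hC₀s] at hlim
  have hev : ∀ᶠ k : ℕ in atTop, cvol (sphNhd C₀ (0 + 1 / ((k:ℝ) + 1))) < cvol A :=
    hlim (Iio_mem_nhds hlt)
  obtain ⟨k, hk⟩ := hev.exists
  set δ : ℝ := 1 / ((k:ℝ) + 1) with hδ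
  have hδ0 : 0 < δ := by positivity
  set ρ : ℝ := D / 2 + δ with hρ
  have hρ0 : 0 < ρ := by rw [hρ]; linarith
  have hρD : D / 2 < ρ := by rw [hρ]; linarith
  have hCρ : cvol (sphCap a ρ) < cvol A := by
    calc cvol (sphCap a ρ) ≤ cvol (sphNhd C₀ (0 + δ)) := by
          rw [zero_add]; exact cvol_mono (sphCap_add_subset_sphNhd ha (by linarith) hδ0.le)
      _ < cvol A := hk
  -- Böröczky–Sagmeister's family 𝓓_{A,D} ∋ A
  have hA_mem : (⟨⟨A, hAc⟩, hAne⟩ : TopologicalSpace.NonemptyCompacts (EuclideanSpace ℝ (Fin 3))) ∈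
      {L : TopologicalSpace.NonemptyCompacts (EuclideanSpace ℝ (Fin 3)) |
        (L : Set (EuclideanSpace ℝ (Fin 3))) ⊆ {x : EuclideanSpace ℝ (Fin 3) | ‖x‖ = 1} ∧
        cvol A ≤ cvol (L : Set (EuclideanSpace ℝ (Fin 3))) ∧
        AngDiamLE (L : Set (EuclideanSpace ℝ (Fin 3))) D} := ⟨hAs, le_rfl, hAD⟩
  obtain ⟨L, hL, hCL⟩ := exists_mem_superset_sphCap ⟨_, hA_mem⟩ (isClosed_famD A D)
    (fun L hL => hL.1)
    (fun L hL n hn M hM => by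
      refine ⟨?_, ?_, ?_⟩
      · rw [hM]; exact tps_subset_unitSphere hL.1
      · rw [hM, cvol_tps hn L.isCompact.isClosed.measurableSet]; exact hL.2.1
      · rw [hM]; exact angDiamLE_tps hn hL.1 hL.2.2)
    ha hρ0 (fun L hL => hCρ.le.trans hL.2.1)
  -- the cap B(a, ρ) has diameter ≤ D, yet contains two points at distance > D
  have hCD : AngDiamLE (sphCap a ρ) D := hL.2.2.mono hCL
  obtain ⟨x, hx, y, hy, hxy⟩ := exists_pair_angle_gt ha hD0.le hDπ hρD
  exact absurd (hCD x hx y hy) (not_le.2 hxy)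

end TwoPointSym

open Real InnerProductGeometry Metric Set TwoPointSym in
/-- **The spherical isodiametric inequality on `S²` (Böröczky–Sagmeister 2019, Theorem 1.2,
inequality half), PROVED** — i.e. the named fact `BoroczkySagmeister2019_sphericalIsodiametric`:
for `X ⊆ S²` with all pairwise geodesic distances `≤ D`, `0 < D < π`, and any unit vector `a`,
`sphereFraction X ≤ sphereFraction (sphCap a (D/2))`.  Proof: pass to the closure (compact, same
diameter bound) and apply `cvol_le_cvol_sphCap_of_angDiamLE` (two-point symmetrization:
Böröczky–Sagmeister's Lemma 3.3 / Lemma 5.1 with Benyamini's extremal argument in place of their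
§§5–6); the measurability hypothesis is not used.
[cite: BoroczkySagmeister2019, Theorem 1.2]
[cite: Schneider2022, Theorem 3.4.1, proof (pp. 124–127)] -/
theorem BoroczkySagmeister2019_sphericalIsodiametric_holds :
    BoroczkySagmeister2019_sphericalIsodiametric := by
  intro X D a hXs _hXm hD0 hDπ hXD ha
  rw [sphereFraction_le_iff]
  rcases X.eq_empty_or_nonempty with hXe | hXne
  · rw [hXe]; exact cvol_mono (empty_subset _)
  · have hS2 : IsClosed ({x : EuclideanSpace ℝ (Fin 3) | ‖x‖ = 1} : Set (EuclideanSpace ℝ (Fin 3))) := by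
      have e : ({x : EuclideanSpace ℝ (Fin 3) | ‖x‖ = 1} : Set (EuclideanSpace ℝ (Fin 3))) =
          sphere (0 : EuclideanSpace ℝ (Fin 3)) 1 := by
        ext x; simp
      rw [e]; exact isClosed_sphere
    have hS2c : IsCompact ({x : EuclideanSpace ℝ (Fin 3) | ‖x‖ = 1} : Set (EuclideanSpace ℝ (Fin 3))) := by
      have e : ({x : EuclideanSpace ℝ (Fin 3) | ‖x‖ = 1} : Set (EuclideanSpace ℝ (Fin 3))) =
          sphere (0 : EuclideanSpace ℝ (Fin 3)) 1 := by
        ext x; simp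
      rw [e]; exact isCompact_sphere _ _
    have hcl : closure X ⊆ {x : EuclideanSpace ℝ (Fin 3) | ‖x‖ = 1} := closure_minimal hXs hS2
    have hclc : IsCompact (closure X) := hS2c.of_isClosed_subset isClosed_closure hcl
    calc cvol X ≤ cvol (closure X) := cvol_mono subset_closure
      _ ≤ cvol (sphCap a (D / 2)) :=
          cvol_le_cvol_sphCap_of_angDiamLE hXne.closure hclc hcl hD0 hDπ
            (angDiamLE_closure hXs hXD) ha

end Literature.Geometry.DiscreteGeometry

end
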